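import Summits.Parity.GeneralizedHardyLittlewood.Theorems.PrimeLevelFamEdgeIdeaDeltasFloorDualParseval
import Mathlib.Analysis.SpecialFunctions.Gaussian.FourierTransform
import Mathlib.Analysis.Complex.ExponentialBounds
import HarnessLib

/-!
# Route `PrimeLevelFamEdge` — TYPED IDEA DELTAS, deck 18i: K-L21-3 — THE WALL IS FINITE (non-vacuity of the no-go
# `heightWallLowerEdge`): `cosTransform_gaussian` (`∫ e^{−su²} cos(2παu) du = √(π/s) e^{−π²α²/s}`, from Mathlib's
# `fourierIntegral_gaussian`), the explicit test function `gaussTest u = 2e^{−6u²} − e^{−3u²}` with window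
# `gaussWindow = √(log 2 / 3) = 0.48068 < ½` IS floor-admissible (`gaussTest_admissible`; `ĝ > 0` everywhere), hence
# `heightCertificate_exists : ∃ c, HeightCertificate c 2 gaussWindow` and `heightWall_bracket` (λ₀ < ½ ∧ no certificate at any
# `c ≤ quarterLevel` ∧ some certificate exists): at `B = 2`, `λ₀ = 0.48068` the wall height is a finite number in
# `(0.7393494, ∞)` (F's numerics: the minimal certifying height of THIS test is 1.2885 — a finiteness witness, not a useful
# certificate).  Seat ls-idea-lens-21 g2, `Sketch_L21_DualWitness.lean` v1.7 sha16 eb0eaca286c62148 l.1868–2065 VERBATIM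
# (critic F b26.9 VERIFIED: axioms std for `heightWall_bracket`, 11 new / 0 changed decls); typer ls-idea-typ-1 gen 3.
# HONESTY: theorems about the one-sided minorant METHOD, nothing about ζ; no exceptional-zero theorem (no Landau–Siegel /
# Siegel-zero exclusion, no Theorem 1–2 of arXiv:2211.02515, no repaired Margin232) is proved; computed ≠ proved for 1.2885.
-/

namespace Summit.Parity.GeneralizedHardyLittlewood.Theorems.PrimeLevelFamEdgeIdeaDeltas.FloorDual

open Literature.NumberTheory.LFunctions MeasureTheory
open scoped Real

/-! ### v1.7 · THE WALL IS FINITE: `HeightCertificate` is inhabited (non-vacuity of the no-go) -/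

section Finite
open Complex (I)

/-- Cosine transform of a Gaussian (PROVED): `∫ e^{−su²} cos(2παu) du = √(π/s) e^{−π²α²/s}`. -/
theorem cosTransform_gaussian {s : ℝ} (hs : 0 < s) (α : ℝ) :
    BGMM2023.cosTransform (fun u => Real.exp (-s * u ^ 2)) α =
      Real.sqrt (π / s) * Real.exp (-(π ^ 2 * α ^ 2) / s) := by
  unfold BGMM2023.cosTransform
  have hsre : 0 < (s : ℂ).re := by simpa using hs
  have key := fourierIntegral_gaussian hsre ((2 * π * α : ℝ) : ℂ)
  have hint : Integrable fun x : ℝ =>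
      Complex.exp (I * ((2 * π * α : ℝ) : ℂ) * (x : ℂ)) * Complex.exp (-(s : ℂ) * (x : ℂ) ^ 2) := by
    refine (integrable_cexp_neg_mul_sq hsre).bdd_mul (c := 1) (by fun_prop) (ae_of_all _ fun x => ?_)
    rw [show I * ((2 * π * α : ℝ) : ℂ) * (x : ℂ) = ((2 * π * α * x : ℝ) : ℂ) * I by push_cast; ring,
      Complex.norm_exp_ofReal_mul_I]
  have hpt : ∀ x : ℝ, (Complex.exp (I * ((2 * π * α : ℝ) : ℂ) * (x : ℂ))
      * Complex.exp (-(s : ℂ) * (x : ℂ) ^ 2)).re = Real.exp (-s * x ^ 2) * Real.cos (2 * π * α * x) := by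
    intro x
    rw [← Complex.exp_add, show I * ((2 * π * α : ℝ) : ℂ) * (x : ℂ) + -(s : ℂ) * (x : ℂ) ^ 2
        = ((-s * x ^ 2 : ℝ) : ℂ) + ((2 * π * α * x : ℝ) : ℂ) * I by push_cast; ring,
      Complex.exp_add, ← Complex.ofReal_exp, Complex.re_ofReal_mul, Complex.exp_ofReal_mul_I_re]
  have h2 := integral_re hint
  simp only [RCLike.re_to_complex, hpt] at h2
  rw [h2, key]
  -- evaluate the real part of the right-hand side
  have hR : (π / (s : ℂ)) ^ (1 / 2 : ℂ) * Complex.exp (-((2 * π * α : ℝ) : ℂ) ^ 2 / (4 * (s : ℂ)))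
      = ((Real.sqrt (π / s) * Real.exp (-(π ^ 2 * α ^ 2) / s) : ℝ) : ℂ) := by
    conv_rhs => rw [Complex.ofReal_mul, Real.sqrt_eq_rpow,
      Complex.ofReal_cpow (le_of_lt (div_pos Real.pi_pos hs)), Complex.ofReal_exp]
    congr 1
    · push_cast; norm_num
    · congr 1; push_cast; field_simp; ring
  rw [hR, Complex.ofReal_re]

/-- The Gaussian test function `g(u) = 2e^{−6u²} − e^{−3u²}`. -/
noncomputable def gaussTest (u : ℝ) : ℝ := 2 * Real.exp (-6 * u ^ 2) - Real.exp (-3 * u ^ 2)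

/-- Its window `λ₀ = √(log 2 / 3) = 0.48…`. -/
noncomputable def gaussWindow : ℝ := Real.sqrt (Real.log 2 / 3)

/-- The window `√(log 2/3) < ½`. -/
theorem gaussWindow_lt_half : gaussWindow < 1 / 2 := by
  unfold gaussWindow
  rw [Real.sqrt_lt' (by norm_num)]
  have := Real.log_two_lt_d9
  norm_num at this ⊢
  linarith

/-- `gaussTest` is integrable. -/
theorem integrable_gaussTest : Integrable gaussTest :=
  ((integrable_exp_neg_mul_sq (by norm_num : (0:ℝ) < 6)).const_mul 2).sub
    (integrable_exp_neg_mul_sq (by norm_num : (0:ℝ) < 3))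

/-- `ĝ(α) = 2√(π/6) e^{−π²α²/6} − √(π/3) e^{−π²α²/3}` (PROVED). -/
theorem cosTransform_gaussTest (α : ℝ) :
    BGMM2023.cosTransform gaussTest α =
      2 * (Real.sqrt (π / 6) * Real.exp (-(π ^ 2 * α ^ 2) / 6))
        - Real.sqrt (π / 3) * Real.exp (-(π ^ 2 * α ^ 2) / 3) := by
  have h6 := cosTransform_gaussian (by norm_num : (0:ℝ) < 6) α
  have h3 := cosTransform_gaussian (by norm_num : (0:ℝ) < 3) α
  unfold BGMM2023.cosTransform at h6 h3 ⊢
  simp only at h6 h3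
  unfold gaussTest
  have i6 := integrable_mul_cos (integrable_exp_neg_mul_sq (by norm_num : (0:ℝ) < 6)) (2 * π * α)
  have i3 := integrable_mul_cos (integrable_exp_neg_mul_sq (by norm_num : (0:ℝ) < 3)) (2 * π * α)
  calc ∫ u : ℝ, (2 * Real.exp (-6 * u ^ 2) - Real.exp (-3 * u ^ 2)) * Real.cos (2 * π * α * u)
      = ∫ u : ℝ, (2 * (Real.exp (-6 * u ^ 2) * Real.cos (2 * π * α * u))
          - Real.exp (-3 * u ^ 2) * Real.cos (2 * π * α * u)) := by
        congr 1; ext u; ring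
    _ = 2 * (∫ u : ℝ, Real.exp (-6 * u ^ 2) * Real.cos (2 * π * α * u))
          - ∫ u : ℝ, Real.exp (-3 * u ^ 2) * Real.cos (2 * π * α * u) := by
        rw [integral_sub (i6.const_mul 2) i3, integral_const_mul]
    _ = _ := by rw [h6, h3]

/-- `√(π/3) < 2√(π/6)`. -/
theorem two_sqrt_pi_six_gt : Real.sqrt (π / 3) < 2 * Real.sqrt (π / 6) := by
  have h1 : Real.sqrt (π / 3) < 1.03 := by
    rw [Real.sqrt_lt' (by norm_num)]
    have := Real.pi_lt_d2; nlinarith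
  have h2 : 0.72 < Real.sqrt (π / 6) := by
    rw [Real.lt_sqrt (by norm_num)]
    have := Real.pi_gt_d2; nlinarith
  linarith

/-- `ĝ > 0` everywhere (PROVED). -/
theorem cosTransform_gaussTest_pos (α : ℝ) : 0 < BGMM2023.cosTransform gaussTest α := by
  rw [cosTransform_gaussTest]
  set A := π ^ 2 * α ^ 2 / 6 with hA
  have hA0 : 0 ≤ A := by positivity
  have e1 : Real.exp (-(π ^ 2 * α ^ 2) / 6) = Real.exp (-A) := by rw [hA]; ring_nf
  have e2 : Real.exp (-(π ^ 2 * α ^ 2) / 3) = Real.exp (-A) * Real.exp (-A) := by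
    rw [← Real.exp_add, hA]; ring_nf
  rw [e1, e2]
  have hE : 0 < Real.exp (-A) := Real.exp_pos _
  have hE1 : Real.exp (-A) ≤ 1 := by rw [Real.exp_le_one_iff]; linarith
  have hs3 : 0 ≤ Real.sqrt (π / 3) := Real.sqrt_nonneg _
  have hgt := two_sqrt_pi_six_gt
  nlinarith [mul_le_mul_of_nonneg_left hE1 (mul_nonneg hs3 hE.le)]

/-- `g` IS floor-admissible with window `λ₀` (PROVED). -/
theorem gaussTest_admissible : IsFloorAdmissible gaussTest gaussWindow where
  even u := by unfold gaussTest; simp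
  continuous := by unfold gaussTest; fun_prop
  integrable := integrable_gaussTest
  map_zero := by unfold gaussTest; simp; norm_num
  nonpos u hu := by
    unfold gaussTest
    unfold gaussWindow at hu
    have h0 : 0 ≤ Real.log 2 / 3 := by positivity
    have hu2 : Real.log 2 / 3 < u ^ 2 := by
      have h2 : Real.sqrt (Real.log 2 / 3) ^ 2 < |u| ^ 2 :=
        pow_lt_pow_left₀ hu (Real.sqrt_nonneg _) two_ne_zero
      rwa [Real.sq_sqrt h0, sq_abs] at h2
    have hy : Real.exp (-3 * u ^ 2) ≤ 1 / 2 := by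
      have : Real.exp (-3 * u ^ 2) ≤ Real.exp (-Real.log 2) := Real.exp_le_exp.mpr (by linarith)
      rw [Real.exp_neg, Real.exp_log two_pos] at this
      simpa using this
    have he : Real.exp (-6 * u ^ 2) = Real.exp (-3 * u ^ 2) * Real.exp (-3 * u ^ 2) := by
      rw [← Real.exp_add]; ring_nf
    rw [he]
    nlinarith [Real.exp_pos (-3 * u ^ 2)]
  transform_nonneg_tail α _ := (cosTransform_gaussTest_pos α).le
  decay := by
    refine ⟨3, fun u => ?_⟩
    unfold gaussTest
    have h3 : Real.exp (-3 * u ^ 2) ≤ 1 / (1 + u ^ 2) := by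
      have h := Real.add_one_le_exp (3 * u ^ 2)
      rw [show -3 * u ^ 2 = -(3 * u ^ 2) by ring, Real.exp_neg, le_div_iff₀ (by positivity)]
      have hpos := Real.exp_pos (3 * u ^ 2)
      rw [inv_mul_le_iff₀ hpos]
      nlinarith [sq_nonneg u]
    have h6 : Real.exp (-6 * u ^ 2) ≤ Real.exp (-3 * u ^ 2) := Real.exp_le_exp.mpr (by nlinarith [sq_nonneg u])
    have hp6 := Real.exp_pos (-6 * u ^ 2)
    have hp3 := Real.exp_pos (-3 * u ^ 2)
    rw [abs_le]
    constructor
    · have : (3 : ℝ) / (1 + u ^ 2) = 3 * (1 / (1 + u ^ 2)) := by ring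
      nlinarith
    · have : (3 : ℝ) / (1 + u ^ 2) = 3 * (1 / (1 + u ^ 2)) := by ring
      nlinarith
  transform_decay := by
    refine ⟨2 * Real.sqrt (π / 6) + Real.sqrt (π / 3), fun α => ?_⟩
    rw [cosTransform_gaussTest]
    have hπ6 : α ^ 2 ≤ π ^ 2 * α ^ 2 / 6 := by
      have hp : 6 ≤ π ^ 2 := by nlinarith [Real.pi_gt_three]
      have := mul_le_mul_of_nonneg_right hp (sq_nonneg α)
      rw [le_div_iff₀ (by norm_num)]; linarith
    have hA : Real.exp (-(π ^ 2 * α ^ 2) / 6) ≤ 1 / (1 + α ^ 2) := by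
      have h := Real.add_one_le_exp (π ^ 2 * α ^ 2 / 6)
      rw [show -(π ^ 2 * α ^ 2) / 6 = -(π ^ 2 * α ^ 2 / 6) by ring, Real.exp_neg,
        le_div_iff₀ (by positivity)]
      have hpos := Real.exp_pos (π ^ 2 * α ^ 2 / 6)
      rw [inv_mul_le_iff₀ hpos]
      nlinarith
    have hB : Real.exp (-(π ^ 2 * α ^ 2) / 3) ≤ 1 / (1 + α ^ 2) :=
      le_trans (Real.exp_le_exp.mpr (by
        have : 0 ≤ π ^ 2 * α ^ 2 := by positivity
        linarith)) hA
    have hs6 := Real.sqrt_nonneg (π / 6)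
    have hs3 := Real.sqrt_nonneg (π / 3)
    have hpA := Real.exp_pos (-(π ^ 2 * α ^ 2) / 6)
    have hpB := Real.exp_pos (-(π ^ 2 * α ^ 2) / 3)
    rw [abs_le]
    have e : (2 * Real.sqrt (π / 6) + Real.sqrt (π / 3)) / (1 + α ^ 2)
        = 2 * Real.sqrt (π / 6) * (1 / (1 + α ^ 2)) + Real.sqrt (π / 3) * (1 / (1 + α ^ 2)) := by ring
    rw [e]
    constructor
    · nlinarith [mul_le_mul_of_nonneg_left hA hs6, mul_le_mul_of_nonneg_left hB hs3,
        mul_nonneg hs6 hpA.le, mul_nonneg hs3 hpB.le]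
    · nlinarith [mul_le_mul_of_nonneg_left hA hs6, mul_le_mul_of_nonneg_left hB hs3,
        mul_nonneg hs6 hpA.le, mul_nonneg hs3 hpB.le]

/-- **THE WALL IS FINITE (PROVED, v1.7):** a one-sided floor certificate EXISTS at some height on
`1 < |α| < 2` for the window `λ₀ = √(log 2/3) = 0.4807 < ½` — so `heightWallLowerEdge` is not vacuous:
the wall height at `B = 2`, `λ = λ₀` is a finite number `> 0.7393494`. -/
theorem heightCertificate_exists : ∃ c : ℝ, HeightCertificate c 2 gaussWindow := by
  have hRc : Continuous (BGMM2023.cosTransform gaussTest) := continuous_cosTransform integrable_gaussTest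
  set J := ∫ α in (1 : ℝ)..2, BGMM2023.cosTransform gaussTest α with hJ
  have hJpos : 0 < J :=
    intervalIntegral.intervalIntegral_pos_of_pos_on (hRc.intervalIntegrable _ _)
      (fun x _ => cosTransform_gaussTest_pos x) (by norm_num)
  refine ⟨(|BGMM2023.cValue gaussTest| + 1) / (2 * J), by norm_num, gaussTest, gaussTest_admissible, ?_⟩
  unfold cValueHeight
  rw [← hJ]
  have : 2 * ((|BGMM2023.cValue gaussTest| + 1) / (2 * J)) * J = |BGMM2023.cValue gaussTest| + 1 := by
    field_simp
  rw [this]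
  have := neg_abs_le (BGMM2023.cValue gaussTest)
  linarith

/-- Corollary (PROVED): the height wall at `B = 2`, window `λ₀ < ½`, lies in `(t, ∞)` with
`t = 0.7393494…` — lower edge by `heightWallLowerEdge`, finiteness by `heightCertificate_exists`. -/
theorem heightWall_bracket :
    gaussWindow < 1 / 2 ∧ (∀ c : ℝ, c ≤ quarterLevel → ¬ HeightCertificate c 2 gaussWindow)
      ∧ ∃ c : ℝ, HeightCertificate c 2 gaussWindow :=
  ⟨gaussWindow_lt_half, fun c hc => heightWallLowerEdge c 2 gaussWindow hc (by norm_num) gaussWindow_lt_half,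
    heightCertificate_exists⟩

end Finite

end Summit.Parity.GeneralizedHardyLittlewood.Theorems.PrimeLevelFamEdgeIdeaDeltas.FloorDual
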